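import Mathlib
import HarnessLib
import Summits.QuantumFields.YangMills.Theorems.MirrorModularBoostsHypercubicLimitPlaneLimitsDefs
import Summits.QuantumFields.YangMills.Theorems.LangevinControlUVOSLegsFromFemtoAndGapStubAssemblyInheritance
import Literature.MathematicalPhysics.QuantumFieldTheory.SchwingerLimitInheritance
import Literature.MathematicalPhysics.QuantumFieldTheory.LatticeGaugeProofs

/-!
# Line `Sketch` (coupling response), Z3a residual: the seam estimate for the renormalised plane-string distributions

Helper file (seam) for stub `stub_translationPlanes` of crux `stmt-QuantumFields-16154` (`HypercubicLimit`), line `Sketch`;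
registered sub-goal `norm_planeDist_translate_sub_le`.  The string weights `W` of `latticeDistStr` are jointly translation
invariant (`torusMomentStr_add_const`), so translating the test function by a lattice vector `a v` only relocates the box
seam, whose terms sit where the test function is Schwartz-small: at ANY Schwartz order `p`,
`‖T(F(· − a v)) − T(F)‖ ≤ 2 (2L+1)^{4n} Mⁿ ‖F‖_{p,0} (a L/2)^{-p}` given `|W| ≤ Mⁿ`
(`norm_latticeDistStr_translate_sub_le_div`, the flexible-order form of the sibling toolkit's
`norm_latticeDistStr_translate_sub_le`).  For the RENORMALISED plane-string distributions `planeDist = (c_k a_k⁴)ⁿ · T` the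
weight scale `|c_k a_k⁴| (C + |m_k/6|)` is polynomial in `a_k⁻¹` (`renormScale_le`): `|c_k| ≤ a_k^{-Q}` is `PolyRenorm`, and
the uncontrolled counterterm only enters through `c_k a_k⁴ m_k/6 = c_k a_k⁴ (⟨p⟩_k − W_k(0))`, where the renormalised one-point
weight `c_k a_k⁴ W_k(0)` is bounded uniformly in `k` by the arity-one functional bound tested against a non-negative bump
(`exists_bound_renorm_weight_one`).  Output: `norm_planeDist_translate_sub_le`.
-/

noncomputable section

open scoped SchwartzMap BigOperators
open MeasureTheory Filter Topology
open Literature.MathematicalPhysics.AQFT Literature.MathematicalPhysics.QuantumLattice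
  Literature.MathematicalPhysics.QuantumFieldTheory
open Literature.Probability.LatticeModels (box Site mem_box zero_mem_box)
open Summit.QuantumFields.YangMills.Theorems.OSLegsFromFemtoAndGap

namespace Summit.QuantumFields.YangMills.Cruxes.HypercubicLimit.CouplingResponse

section Seam

variable {G : Type} [Group G] [TopologicalSpace G] [IsTopologicalGroup G] [CompactSpace G]
  [MeasurableSpace G] [BorelSpace G]

/-- **The translation defect of `latticeDistStr` at any Schwartz order** (wrap zone only): given the sup bound
`|W| ≤ Mⁿ` on the weights, for a lattice vector `v` with `2‖v‖ ≤ L`, `0 < a`, `1 ≤ L` and every order `p`,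
`‖T(F(· − a v)) − T(F)‖ ≤ 2 (2L+1)^{4n} Mⁿ ‖F‖_{p,0} / (a L / 2)^p` — the weights are jointly translation
invariant, so only the multi-sites leaving or entering the box contribute, and those have a component of physical
norm `≥ a L / 2`. [folklore] -/
theorem norm_latticeDistStr_translate_sub_le_div {N : ℕ} (ρ : G →* Matrix (Fin N) (Fin N) ℂ) (β : ℝ) (L : ℕ)
    {n : ℕ} (O : Fin n → LGConfig 4 G → ℝ) (m : Fin n → ℝ) {M : ℝ} (hM : 0 ≤ M)
    (hW : ∀ x : Fin n → Site 4, |torusMomentStr ρ β L O m x| ≤ M ^ n) {a : ℝ} (ha : 0 < a)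
    (hL : 1 ≤ L) (v : Site 4) (hv : 2 * ‖v‖ ≤ (L : ℝ)) (p : ℕ) (F : 𝓢((Fin n → EuclideanSpace ℝ (Fin 4)), ℂ)) :
    ‖latticeDistStr ρ β L a O m (translateMulti (a • siteToE v) F) - latticeDistStr ρ β L a O m F‖ ≤
      2 * ((2 * L + 1 : ℕ) : ℝ) ^ (4 * n) * (M ^ n * (SchwartzMap.seminorm ℂ p 0 F / (a * L / 2) ^ p)) := by
  -- adapted from `OSLegsFromFemtoAndGap.norm_latticeDistStr_translate_sub_le` (Steps 1–4, the Schwartz order made free)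
  classical
  -- the two index sets and the summand
  set S₁ : Finset (Fin n → Site 4) := Fintype.piFinset (fun _ : Fin n => box 4 L) with hS₁
  set vv : Fin n → Site 4 := fun _ => v with hvv
  set e : (Fin n → Site 4) ≃ (Fin n → Site 4) := Equiv.subRight vv with he
  set S₂ : Finset (Fin n → Site 4) := S₁.map e.toEmbedding with hS₂
  set g : (Fin n → Site 4) → ℂ := fun y =>
    ((torusMomentStr ρ β L O m y : ℝ) : ℂ) * F (fun i => a • siteToE (y i)) with hg
  -- Step 1: the translated distribution is the same sum over the shifted index set
  have h1 : latticeDistStr ρ β L a O m (translateMulti (a • siteToE v) F) = ∑ y ∈ S₂, g y := by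
    rw [latticeDistStr_apply, Finset.sum_map]
    refine Finset.sum_congr rfl fun x _ => ?_
    have hx : e x = fun i => x i + -v := by
      funext i; simp [he, hvv, sub_eq_add_neg]
    simp only [hg, Equiv.coe_toEmbedding, hx, translateMulti_apply, torusMomentStr_add_const]
    congr 2
    funext i
    rw [← sub_eq_add_neg, Summit.QuantumFields.YangMills.Theorems.OSLegsFromFemtoAndGap.siteToE_sub, smul_sub]
  have h2 : latticeDistStr ρ β L a O m F = ∑ y ∈ S₁, g y := latticeDistStr_apply ρ β L a O m F
  rw [h1, h2, ← Finset.sum_sdiff_sub_sum_sdiff]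
  -- Step 2: sizes
  have hL1 : (1 : ℝ) ≤ L := by exact_mod_cast hL
  set t : ℝ := a * L / 2 with ht
  have htpos : 0 < t := by positivity
  set B : ℝ := M ^ n * (SchwartzMap.seminorm ℂ p 0 F / t ^ p) with hB
  have hB0 : 0 ≤ B := by positivity
  -- Step 3: per-term bound in the wrap zone
  have hterm : ∀ y : Fin n → Site 4, (∃ i, (L : ℝ) < 2 * ‖y i‖) → ‖g y‖ ≤ B := by
    rintro y ⟨i, hi⟩
    rw [hg]; dsimp only
    rw [norm_mul, Complex.norm_real, Real.norm_eq_abs, hB]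
    refine mul_le_mul (hW y) ?_ (norm_nonneg _) (pow_nonneg hM n)
    refine norm_apply_le_seminorm_div F p htpos i ?_
    have := mul_norm_le_norm_smul_siteToE ha.le (y i)
    have : t ≤ a * ‖y i‖ := by rw [ht]; nlinarith
    linarith
  have hA : ∀ y ∈ S₂ \ S₁, ∃ i, (L : ℝ) < 2 * ‖y i‖ := by
    intro y hy
    rw [Finset.mem_sdiff] at hy
    obtain ⟨i, hi⟩ := exists_lt_norm_of_not_mem_piFinset_box hy.2
    exact ⟨i, by linarith [norm_nonneg (y i)]⟩
  have hBset : ∀ y ∈ S₁ \ S₂, ∃ i, (L : ℝ) < 2 * ‖y i‖ := by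
    intro y hy
    rw [Finset.mem_sdiff] at hy
    have hy2 : y + vv ∉ S₁ := by
      intro h
      apply hy.2
      rw [hS₂, Finset.mem_map_equiv]
      have : e.symm y = y + vv := by funext i; simp [he]
      rwa [this]
    obtain ⟨i, hi⟩ := exists_lt_norm_of_not_mem_piFinset_box hy2
    refine ⟨i, ?_⟩
    have h3 : ‖(y + vv) i‖ ≤ ‖y i‖ + ‖v‖ := by
      simpa [hvv] using norm_add_le (y i) v
    linarith
  -- Step 4: sum the bounds
  have hcard₁ : (S₁.card : ℝ) = ((2 * L + 1 : ℕ) : ℝ) ^ (4 * n) := by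
    rw [hS₁, Fintype.card_piFinset, Finset.prod_const, Finset.card_univ, Fintype.card_fin,
      Literature.Probability.LatticeModels.card_box, ← pow_mul]
    push_cast
    ring
  have hcard₂ : (S₂.card : ℝ) = ((2 * L + 1 : ℕ) : ℝ) ^ (4 * n) := by
    rw [hS₂, Finset.card_map, hcard₁]
  have hsum₁ : ‖∑ y ∈ S₂ \ S₁, g y‖ ≤ ((2 * L + 1 : ℕ) : ℝ) ^ (4 * n) * B := by
    calc ‖∑ y ∈ S₂ \ S₁, g y‖ ≤ ∑ y ∈ S₂ \ S₁, ‖g y‖ := norm_sum_le _ _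
      _ ≤ ∑ _y ∈ S₂ \ S₁, B := Finset.sum_le_sum fun y hy => hterm y (hA y hy)
      _ = ((S₂ \ S₁).card : ℝ) * B := by rw [Finset.sum_const, nsmul_eq_mul]
      _ ≤ (S₂.card : ℝ) * B := by gcongr; exact Finset.sdiff_subset
      _ = _ := by rw [hcard₂]
  have hsum₂ : ‖∑ y ∈ S₁ \ S₂, g y‖ ≤ ((2 * L + 1 : ℕ) : ℝ) ^ (4 * n) * B := by
    calc ‖∑ y ∈ S₁ \ S₂, g y‖ ≤ ∑ y ∈ S₁ \ S₂, ‖g y‖ := norm_sum_le _ _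
      _ ≤ ∑ _y ∈ S₁ \ S₂, B := Finset.sum_le_sum fun y hy => hterm y (hBset y hy)
      _ = ((S₁ \ S₂).card : ℝ) * B := by rw [Finset.sum_const, nsmul_eq_mul]
      _ ≤ (S₁.card : ℝ) * B := by gcongr; exact Finset.sdiff_subset
      _ = _ := by rw [hcard₁]
  calc ‖∑ y ∈ S₂ \ S₁, g y - ∑ y ∈ S₁ \ S₂, g y‖
      ≤ ‖∑ y ∈ S₂ \ S₁, g y‖ + ‖∑ y ∈ S₁ \ S₂, g y‖ := norm_sub_le _ _
    _ ≤ ((2 * L + 1 : ℕ) : ℝ) ^ (4 * n) * B + ((2 * L + 1 : ℕ) : ℝ) ^ (4 * n) * B := add_le_add hsum₁ hsum₂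
    _ = 2 * ((2 * L + 1 : ℕ) : ℝ) ^ (4 * n) * B := by ring

/-- **Sup bound for string weights**: `|W(x)| ≤ (C + μ)ⁿ` whenever `|Oᵢ| ≤ C` and `|mᵢ| ≤ μ` (Wilson's measure is a
probability measure). [folklore] -/
theorem abs_torusMomentStr_le_pow (r : LatticeRep G) (β : ℝ) (L : ℕ) {n : ℕ} (O : Fin n → LGConfig 4 G → ℝ)
    (m : Fin n → ℝ) {C μ : ℝ} (hO : ∀ i U, |O i U| ≤ C) (hm : ∀ i, |m i| ≤ μ) (x : Fin n → Site 4) :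
    |torusMomentStr r.ρ β L O m x| ≤ (C + μ) ^ n := by
  -- adapted from `OSLegsFromFemtoAndGap.abs_torusMoment_le_pow`
  haveI := isProbabilityMeasure_wilsonMeasure (d := 4) (L := 2 * L + 1) r.ρ r.continuous β
  unfold torusMomentStr
  have hbound : ∀ U : GaugeConfig 4 (2 * L + 1) G,
      ‖∏ i, (O i (configShift (-(x i)) (torusLift (2 * L + 1) U)) - m i)‖ ≤ (C + μ) ^ n := fun U => by
    rw [Real.norm_eq_abs, Finset.abs_prod]
    calc ∏ i, |O i (configShift (-(x i)) (torusLift (2 * L + 1) U)) - m i|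
        ≤ ∏ _i : Fin n, (C + μ) := Finset.prod_le_prod (fun _ _ => abs_nonneg _) fun i _ =>
          (abs_sub _ _).trans (add_le_add (hO i _) (hm i))
      _ = (C + μ) ^ n := by simp
  have h := norm_integral_le_of_norm_le_const (μ := wilsonMeasure (d := 4) (L := 2 * L + 1) r.ρ β)
    (Eventually.of_forall hbound)
  simpa [Real.norm_eq_abs] using h

/-- One common sup bound for the six plaquette observables. [folklore] -/
theorem exists_bound_planeSpecies (r : LatticeRep G) :
    ∃ C : ℝ, 0 ≤ C ∧ ∀ (q : Plane) (U : LGConfig 4 G), |(planeSpecies r q).F U| ≤ C := by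
  choose C hC using fun q : Plane => (planeSpecies r q).bounded
  refine ⟨∑ q, |C q|, Finset.sum_nonneg fun q _ => abs_nonneg _, fun q U => ?_⟩
  calc |(planeSpecies r q).F U| ≤ C q := hC q U
    _ ≤ |C q| := le_abs_self _
    _ ≤ ∑ q', |C q'| := Finset.single_le_sum (fun q' _ => abs_nonneg (C q')) (Finset.mem_univ q)

omit [IsTopologicalGroup G] [CompactSpace G] [BorelSpace G] in
/-- A non-negative real-valued one-point test function with value `1` at the origin (a smooth bump). [folklore] -/
theorem exists_nonneg_test_fin_one :
    ∃ g : 𝓢((Fin 1 → EuclideanSpace ℝ (Fin 4)), ℂ), (∀ y, ∃ t : ℝ, 0 ≤ t ∧ g y = t) ∧ g 0 = 1 := by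
  let b : ContDiffBump (0 : Fin 1 → EuclideanSpace ℝ (Fin 4)) := ⟨1, 2, one_pos, one_lt_two⟩
  refine ⟨HasCompactSupport.toSchwartzMap (f := fun x => ((b x : ℝ) : ℂ))
      (b.hasCompactSupport.comp_left Complex.ofReal_zero) (Complex.ofRealCLM.contDiff.comp b.contDiff),
    fun y => ⟨b y, b.nonneg, rfl⟩, ?_⟩
  show ((b 0 : ℝ) : ℂ) = 1
  rw [b.one_of_mem_closedBall (Metric.mem_closedBall_self b.rIn_pos.le), Complex.ofReal_one]

/-- One-point string weights do not depend on the site (translation invariance of Wilson's measure). [folklore] -/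
theorem torusMomentStr_fin_one_eq {N : ℕ} (ρ : G →* Matrix (Fin N) (Fin N) ℂ) (β : ℝ) (L : ℕ)
    (O : Fin 1 → LGConfig 4 G → ℝ) (m : Fin 1 → ℝ) (x : Fin 1 → Site 4) :
    torusMomentStr ρ β L O m x = torusMomentStr ρ β L O m (fun _ => 0) := by
  have hx : x = fun i => (fun _ : Fin 1 => (0 : Site 4)) i + x 0 := by
    funext i
    rw [Fin.fin_one_eq_zero i]
    simp
  rw [hx, torusMomentStr_add_const]

/-- The one-point weight of a bounded observable differs from minus its normalisation by the mean of the observable,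
bounded by its sup: `|W + μ| ≤ C`. [folklore] -/
theorem abs_torusMomentStr_fin_one_add_le (r : LatticeRep G) (β : ℝ) (L : ℕ) (s : YMSpecies G) {C : ℝ}
    (hC : ∀ U, |s.F U| ≤ C) (μ : ℝ) (x : Fin 1 → Site 4) :
    |torusMomentStr r.ρ β L (fun _ : Fin 1 => s.F) (fun _ => μ) x + μ| ≤ C := by
  haveI := isProbabilityMeasure_wilsonMeasure (d := 4) (L := 2 * L + 1) r.ρ r.continuous β
  unfold torusMomentStr
  simp only [Fin.prod_univ_one]
  have hmeas : Measurable fun U : GaugeConfig 4 (2 * L + 1) G =>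
      s.F (configShift (-(x 0)) (torusLift (2 * L + 1) U)) :=
    s.measurable.comp ((configShift _).measurable.comp (measurable_torusLift _))
  have hint : Integrable (fun U : GaugeConfig 4 (2 * L + 1) G =>
      s.F (configShift (-(x 0)) (torusLift (2 * L + 1) U))) (wilsonMeasure (d := 4) (L := 2 * L + 1) r.ρ β) :=
    Integrable.of_bound (C := C) hmeas.aestronglyMeasurable
      (Eventually.of_forall fun U => by rw [Real.norm_eq_abs]; exact hC _)
  rw [integral_sub hint (integrable_const μ), integral_const, probReal_univ, one_smul, sub_add_cancel]
  have h := norm_integral_le_of_norm_le_const (μ := wilsonMeasure (d := 4) (L := 2 * L + 1) r.ρ β) (C := C)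
    (f := fun U => s.F (configShift (-(x 0)) (torusLift (2 * L + 1) U)))
    (Eventually.of_forall fun U => by rw [Real.norm_eq_abs]; exact hC _)
  rwa [probReal_univ, mul_one, Real.norm_eq_abs] at h

/-- The one-point renormalised plane distribution is `c_k a_k⁴ · w · Σₓ g(a_k x)` with the site-independent weight
`w = W(0)`. [folklore] -/
theorem planeDist_one_apply (r : LatticeRep G) (sch : SpeciesScheme (YMSpecies G)) (k : ℕ) (q : Plane)
    (g : 𝓢((Fin 1 → EuclideanSpace ℝ (Fin 4)), ℂ)) :
    planeDist r sch k 1 (fun _ => q) g =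
      ((sch.c r.curvature k * sch.a k ^ 4 *
          torusMomentStr r.ρ (sch.β k) (sch.L k) (fun _ : Fin 1 => (planeSpecies r q).F)
            (fun _ => sch.m r.curvature k / 6) (fun _ => 0) : ℝ) : ℂ) *
        ∑ x ∈ Fintype.piFinset (fun _ : Fin 1 => box 4 (sch.L k)), g (fun i => sch.a k • siteToE (x i)) := by
  unfold planeDist
  rw [FunLike.coe_smul, Pi.smul_apply, latticeDistStr_apply, smul_eq_mul, pow_one, Finset.mul_sum,
    Finset.mul_sum]
  refine Finset.sum_congr rfl fun x _ => ?_
  rw [torusMomentStr_fin_one_eq _ _ _ _ _ x]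
  push_cast
  ring

/-- **The renormalised one-point weights are bounded uniformly in `k`**: `|c_k a_k⁴ W_k^{q}(0)| ≤ A` for all steps and
planes, from the uniform functional bound at arity one tested against a non-negative bump equal to `1` at the origin (every
lattice sum of the bump is `≥ 1`, so no cancellation can hide the weight). [folklore] -/
theorem exists_bound_renorm_weight_one (r : LatticeRep G) (sch : SpeciesScheme (YMSpecies G))
    (hU : UniformFunctionalBoundPlanes r sch) :
    ∃ A : ℝ, 0 ≤ A ∧ ∀ (k : ℕ) (q : Plane),
      |sch.c r.curvature k * sch.a k ^ 4 *
          torusMomentStr r.ρ (sch.β k) (sch.L k) (fun _ : Fin 1 => (planeSpecies r q).F)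
            (fun _ => sch.m r.curvature k / 6) (fun _ => 0)| ≤ A := by
  obtain ⟨s, α, β, hb⟩ := hU
  obtain ⟨g, hg, hg0⟩ := exists_nonneg_test_fin_one
  choose t ht0 htg using hg
  have hgoff : IsOffDiagonal g := isOffDiagonal_of_subsingleton g
  set A : ℝ := α * ((Nat.factorial 1 : ℕ) : ℝ) ^ β * schwartzNorm (1 * s) g with hA
  have key : ∀ (k : ℕ) (q : Plane),
      |sch.c r.curvature k * sch.a k ^ 4 *
          torusMomentStr r.ρ (sch.β k) (sch.L k) (fun _ : Fin 1 => (planeSpecies r q).F)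
            (fun _ => sch.m r.curvature k / 6) (fun _ => 0)| ≤ A := by
    intro k q
    have hk := hb 1 (fun _ => q) g hgoff k
    rw [planeDist_one_apply] at hk
    set w : ℝ := sch.c r.curvature k * sch.a k ^ 4 *
      torusMomentStr r.ρ (sch.β k) (sch.L k) (fun _ : Fin 1 => (planeSpecies r q).F)
        (fun _ => sch.m r.curvature k / 6) (fun _ => 0) with hw
    set S : Finset (Fin 1 → Site 4) := Fintype.piFinset (fun _ : Fin 1 => box 4 (sch.L k)) with hS
    -- the lattice sum of the bump is a real number `≥ 1`
    have hsum : ∑ x ∈ S, g (fun i => sch.a k • siteToE (x i)) =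
        ((∑ x ∈ S, t (fun i => sch.a k • siteToE (x i)) : ℝ) : ℂ) := by
      rw [Complex.ofReal_sum]
      exact Finset.sum_congr rfl fun x _ => htg _
    have hge : (1 : ℝ) ≤ ∑ x ∈ S, t (fun i => sch.a k • siteToE (x i)) := by
      have h0 : (fun _ : Fin 1 => (0 : Site 4)) ∈ S := by
        rw [hS, Fintype.mem_piFinset]
        exact fun _ => zero_mem_box 4 _
      have hpt : (fun i : Fin 1 => sch.a k • siteToE ((fun _ : Fin 1 => (0 : Site 4)) i)) = (0 : Fin 1 → EuclideanSpace ℝ (Fin 4)) := by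
        funext i
        ext l
        simp [siteToE_apply]
      have ht1 : t (fun i : Fin 1 => sch.a k • siteToE ((fun _ : Fin 1 => (0 : Site 4)) i)) = 1 := by
        rw [hpt]
        have h := htg 0
        rw [hg0] at h
        exact_mod_cast h.symm
      calc (1 : ℝ) = t (fun i : Fin 1 => sch.a k • siteToE ((fun _ : Fin 1 => (0 : Site 4)) i)) := ht1.symm
        _ ≤ ∑ x ∈ S, t (fun i => sch.a k • siteToE (x i)) :=
            Finset.single_le_sum (f := fun x : Fin 1 → Site 4 => t (fun i => sch.a k • siteToE (x i)))
              (fun x _ => ht0 _) h0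
    have hs0 : (0 : ℝ) ≤ ∑ x ∈ S, t (fun i => sch.a k • siteToE (x i)) := by linarith
    rw [hsum, norm_mul, Complex.norm_real, Complex.norm_real, Real.norm_eq_abs, Real.norm_eq_abs,
      abs_of_nonneg hs0] at hk
    calc |w| = |w| * 1 := (mul_one _).symm
      _ ≤ |w| * ∑ x ∈ S, t (fun i => sch.a k • siteToE (x i)) := by gcongr
      _ ≤ A := hk
  have q₀ : Plane := ⟨((0 : Fin 4), (1 : Fin 4)), by decide⟩
  exact ⟨A, (abs_nonneg _).trans (key 0 q₀), key⟩

/-- **Polynomial bound on the renormalised weight scale.**  With `C` a common sup bound of the plaquettes, `A` the bound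
of `exists_bound_renorm_weight_one` and `|c_k| ≤ a_k^{-Q}` (`PolyRenorm`), for `a_k ≤ 1`:
`|c_k a_k⁴| (C + |m_k/6|) ≤ (2C + A) a_k^{-Q}` — the uncontrolled counterterm only enters through
`c_k a_k⁴ m_k/6 = c_k a_k⁴ (⟨p⟩_k − W_k(0))`. [folklore] -/
theorem renormScale_le (r : LatticeRep G) (sch : SpeciesScheme (YMSpecies G)) {C A : ℝ} {Q : ℕ} (hC0 : 0 ≤ C)
    (hC : ∀ (q : Plane) (U : LGConfig 4 G), |(planeSpecies r q).F U| ≤ C)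
    (hA : ∀ (k : ℕ) (q : Plane), |sch.c r.curvature k * sch.a k ^ 4 *
        torusMomentStr r.ρ (sch.β k) (sch.L k) (fun _ : Fin 1 => (planeSpecies r q).F)
          (fun _ => sch.m r.curvature k / 6) (fun _ => 0)| ≤ A)
    (hQ : ∀ k, |sch.c r.curvature k| ≤ (sch.a k)⁻¹ ^ Q) (k : ℕ) (hk1 : sch.a k ≤ 1) :
    |sch.c r.curvature k * sch.a k ^ 4| * (C + |sch.m r.curvature k / 6|) ≤ (2 * C + A) * (sch.a k)⁻¹ ^ Q := by
  have ha := sch.a_pos k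
  let q₀ : Plane := ⟨((0 : Fin 4), (1 : Fin 4)), by decide⟩
  set c : ℝ := sch.c r.curvature k with hc
  set a : ℝ := sch.a k with hadef
  set μ : ℝ := sch.m r.curvature k / 6 with hμ
  set w : ℝ := torusMomentStr r.ρ (sch.β k) (sch.L k) (fun _ : Fin 1 => (planeSpecies r q₀).F) (fun _ => μ)
    (fun _ => 0) with hw
  have hwμ : |w + μ| ≤ C := abs_torusMomentStr_fin_one_add_le r _ _ (planeSpecies r q₀) (hC q₀) μ _
  have hcw : |c * a ^ 4 * w| ≤ A := hA k q₀
  have hA0 : 0 ≤ A := (abs_nonneg _).trans hcw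
  have hca4 : |c * a ^ 4| = |c| * a ^ 4 := by rw [abs_mul, abs_of_pos (pow_pos ha 4)]
  have ha4 : a ^ 4 ≤ 1 := pow_le_one₀ ha.le hk1
  -- the counterterm: `|c a⁴| |μ| ≤ |c a⁴| |w + μ| + |c a⁴ w| ≤ |c| a⁴ C + A`
  have h1 : |c * a ^ 4| * |μ| ≤ |c| * a ^ 4 * C + A := by
    have hsplit : c * a ^ 4 * μ = c * a ^ 4 * (w + μ) - c * a ^ 4 * w := by ring
    calc |c * a ^ 4| * |μ| = |c * a ^ 4 * μ| := (abs_mul _ _).symm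
      _ = |c * a ^ 4 * (w + μ) - c * a ^ 4 * w| := by rw [hsplit]
      _ ≤ |c * a ^ 4 * (w + μ)| + |c * a ^ 4 * w| := abs_sub _ _
      _ = |c| * a ^ 4 * |w + μ| + |c * a ^ 4 * w| := by rw [abs_mul (c * a ^ 4), hca4]
      _ ≤ |c| * a ^ 4 * C + A := by gcongr
  -- the scale: `|c| a⁴ ≤ |c| ≤ a^{-Q}`, and `1 ≤ a^{-Q}`
  have h2 : |c| * a ^ 4 ≤ a⁻¹ ^ Q :=
    calc |c| * a ^ 4 ≤ |c| * 1 := by gcongr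
      _ = |c| := mul_one _
      _ ≤ a⁻¹ ^ Q := hQ k
  have hinv1 : (1 : ℝ) ≤ a⁻¹ ^ Q := one_le_pow₀ (one_le_inv_iff₀.2 ⟨ha, hk1⟩)
  calc |c * a ^ 4| * (C + |μ|) = |c| * a ^ 4 * C + |c * a ^ 4| * |μ| := by rw [hca4]; ring
    _ ≤ |c| * a ^ 4 * C + (|c| * a ^ 4 * C + A) := by linarith
    _ = 2 * C * (|c| * a ^ 4) + A * 1 := by ring
    _ ≤ 2 * C * a⁻¹ ^ Q + A * a⁻¹ ^ Q := by gcongr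
    _ = (2 * C + A) * a⁻¹ ^ Q := by ring

end Seam

/-- **The translation defect of one renormalised plane-string distribution** at step `k`, at any Schwartz order `p`
(registered sub-goal of the seam file): for `a_k ≤ 1`, `1 ≤ L_k` and a lattice vector `v` with `2‖v‖ ≤ L_k`,
`‖planeDist_k(F(· − a_k v)) − planeDist_k(F)‖ ≤ 2 (2L_k+1)^{4n} ((2C + A) a_k^{-Q})ⁿ ‖F‖_{p,0} / (a_k L_k/2)^p`, where `C`
bounds the plaquettes, `A` the renormalised one-point weights and `|c_k| ≤ a_k^{-Q}`. [folklore] -/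
theorem norm_planeDist_translate_sub_le : ∀ {G : Type} [Group G] [TopologicalSpace G] [IsTopologicalGroup G] [CompactSpace G] [MeasurableSpace G] [BorelSpace G] (r : LatticeRep G) (sch : SpeciesScheme (YMSpecies G)) {C A : ℝ} {Q : ℕ}, 0 ≤ C → (∀ (q : Plane) (U : LGConfig 4 G), |(planeSpecies r q).F U| ≤ C) → (∀ (k : ℕ) (q : Plane), |sch.c r.curvature k * sch.a k ^ 4 * torusMomentStr r.ρ (sch.β k) (sch.L k) (fun _ : Fin 1 => (planeSpecies r q).F) (fun _ => sch.m r.curvature k / 6) (fun _ => 0)| ≤ A) → (∀ k : ℕ, |sch.c r.curvature k| ≤ (sch.a k)⁻¹ ^ Q) → ∀ (k : ℕ), sch.a k ≤ 1 → 1 ≤ sch.L k → ∀ (v : Site 4), 2 * ‖v‖ ≤ (sch.L k : ℝ) → ∀ {n : ℕ} (q : Fin n → Plane) (p : ℕ) (F : 𝓢((Fin n → EuclideanSpace ℝ (Fin 4)), ℂ)), ‖planeDist r sch k n q (translateMulti (sch.a k • siteToE v) F) - planeDist r sch k n q F‖ ≤ 2 * ((2 * sch.L k + 1 : ℕ) :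 ℝ) ^ (4 * n) * (((2 * C + A) * (sch.a k)⁻¹ ^ Q) ^ n * (SchwartzMap.seminorm ℂ p 0 F / (sch.a k * sch.L k / 2) ^ p)) := by
  intro G _ _ _ _ _ _ r sch C A Q hC0 hC hA hQ k hk1 hL v hv n q p F
  have ha := sch.a_pos k
  have hM : 0 ≤ C + |sch.m r.curvature k / 6| := by positivity
  have hW : ∀ x : Fin n → Site 4, |torusMomentStr r.ρ (sch.β k) (sch.L k) (fun i => (planeSpecies r (q i)).F)
      (fun _ => sch.m r.curvature k / 6) x| ≤ (C + |sch.m r.curvature k / 6|) ^ n := fun x =>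
    abs_torusMomentStr_le_pow r _ _ _ _ (fun i U => hC (q i) U) (fun _ => le_rfl) x
  have hseam := norm_latticeDistStr_translate_sub_le_div r.ρ (sch.β k) (sch.L k)
    (fun i => (planeSpecies r (q i)).F) (fun _ => sch.m r.curvature k / 6) hM hW ha hL v hv p F
  have hscale : |(sch.c r.curvature k * sch.a k ^ 4) ^ n| * (C + |sch.m r.curvature k / 6|) ^ n ≤
      ((2 * C + A) * (sch.a k)⁻¹ ^ Q) ^ n := by
    rw [abs_pow, ← mul_pow]
    exact pow_le_pow_left₀ (by positivity) (renormScale_le r sch hC0 hC hA hQ k hk1) n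
  have hdiff : planeDist r sch k n q (translateMulti (sch.a k • siteToE v) F) - planeDist r sch k n q F =
      (((sch.c r.curvature k * sch.a k ^ 4) ^ n : ℝ) : ℂ) *
        (latticeDistStr r.ρ (sch.β k) (sch.L k) (sch.a k) (fun i => (planeSpecies r (q i)).F)
            (fun _ => sch.m r.curvature k / 6) (translateMulti (sch.a k • siteToE v) F) -
          latticeDistStr r.ρ (sch.β k) (sch.L k) (sch.a k) (fun i => (planeSpecies r (q i)).F)
            (fun _ => sch.m r.curvature k / 6) F) := by
    simp only [planeDist, FunLike.coe_smul, Pi.smul_apply, smul_eq_mul, mul_sub]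
  rw [hdiff, norm_mul, Complex.norm_real, Real.norm_eq_abs]
  calc |(sch.c r.curvature k * sch.a k ^ 4) ^ n| *
        ‖latticeDistStr r.ρ (sch.β k) (sch.L k) (sch.a k) (fun i => (planeSpecies r (q i)).F)
            (fun _ => sch.m r.curvature k / 6) (translateMulti (sch.a k • siteToE v) F) -
          latticeDistStr r.ρ (sch.β k) (sch.L k) (sch.a k) (fun i => (planeSpecies r (q i)).F)
            (fun _ => sch.m r.curvature k / 6) F‖
      ≤ |(sch.c r.curvature k * sch.a k ^ 4) ^ n| *
          (2 * ((2 * sch.L k + 1 : ℕ) : ℝ) ^ (4 * n) * ((C + |sch.m r.curvature k / 6|) ^ n *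
            (SchwartzMap.seminorm ℂ p 0 F / (sch.a k * sch.L k / 2) ^ p))) := by
        gcongr
    _ = 2 * ((2 * sch.L k + 1 : ℕ) : ℝ) ^ (4 * n) *
          ((|(sch.c r.curvature k * sch.a k ^ 4) ^ n| * (C + |sch.m r.curvature k / 6|) ^ n) *
            (SchwartzMap.seminorm ℂ p 0 F / (sch.a k * sch.L k / 2) ^ p)) := by ring
    _ ≤ 2 * ((2 * sch.L k + 1 : ℕ) : ℝ) ^ (4 * n) *
          (((2 * C + A) * (sch.a k)⁻¹ ^ Q) ^ n *
            (SchwartzMap.seminorm ℂ p 0 F / (sch.a k * sch.L k / 2) ^ p)) := by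
        gcongr

end Summit.QuantumFields.YangMills.Cruxes.HypercubicLimit.CouplingResponse

end
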